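import Summits.NavierStokesRegularity.NavierStokesRegularity.Theorems.PerpetualPumpAveragedTypeIBlowupOneStepCore
import Summits.NavierStokesRegularity.NavierStokesRegularity.Theorems.PerpetualPumpAveragedTypeIBlowupPreBoot
import Summits.NavierStokesRegularity.NavierStokesRegularity.Theorems.PerpetualPumpAveragedTypeIBlowupPulseBoot
import Summits.NavierStokesRegularity.NavierStokesRegularity.Theorems.PerpetualPumpAveragedTypeIBlowupHandoff

/-!
# Crux `PerpetualPump.AveragedTypeIBlowup` (stmt-NavierStokesRegularity-1835), line `Sketch`:
# THE WINDOW ONE-STEP THEOREM `stub_oneStep` (abstract critical Toda system with memory errors)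

Composition of the lead's case analysis `stub_oneStepCore` with the three phase packages: the pre-ignition
bootstrap `stub_preBoot`, the pulse-phase bootstrap `stub_pulseBoot` and the hand-off `stub_handoff`.
[cite: Tao2016AveragedNS, §5]
-/

noncomputable section
set_option linter.dupNamespace false

open Set MeasureTheory

namespace Summit.NavierStokesRegularity.NavierStokesRegularity.Theorems.PerpetualPumpAveragedTypeIBlowup

/-- **THE WINDOW ONE-STEP THEOREM** (registered stub `stub_oneStep` of line `Sketch`): for a solution of the
critical Toda system with memory errors on `[0,T]` carrying the hand-off invariant `Inv n B t₀` with `B` in the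
range `[blo, bhi]`, either the next hand-off `Inv (n+1) B' t₁` is certified inside `(t₀,T)` with
`t₁ ≤ t₀ + 4/R n`, the one-sided growth bounds, the tube and the strict first crossing of `1` by the next carrier,
or `T < t₀ + 4/R n` and the tube holds on `[t₀,T]`. [cite: Tao2016AveragedNS, §5] -/
theorem stub_oneStep :
    ∀ (ε₀ D εb θ η F blo bhi : ℝ) (n₀ : ℤ) (bv wv M0 M1 db dw : ℤ → ℝ → ℝ) (q : ℝ) (R : ℤ → ℝ) (lad : ℕ → ℝ)
      (G0 G1 : ℤ → ℝ → ℝ) (Inv : ℤ → ℝ → ℝ → Prop) (Tube : ℤ → ℝ → Prop) (n : ℤ) (B t₀ T : ℝ),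
      q = Real.sqrt (1 + ε₀) → (∀ k : ℤ, R k = D * (1 + ε₀) ^ (2 * k)) →
      (∀ j : ℕ, lad j = εb * ((1 + ε₀) ^ (19 * (j - 2)))⁻¹) →
      (∀ (k : ℤ) (t : ℝ), G0 k t = (wv (k - 1) t) ^ 2 / q ^ 3 - (wv k t) ^ 2 - εb * bv k t * wv k t) →
      (∀ (k : ℤ) (t : ℝ), G1 k t = wv k t * (bv k t - bv (k + 1) t / q) + εb * (bv k t) ^ 2) →
      (∀ (m : ℤ) (Bm t : ℝ), Inv m Bm t ↔
        (bv m t = Bm ∧ (∀ s ∈ Icc 0 t, bv m s ≤ Bm) ∧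
        (0 ≤ wv m t ∧ wv m t ≤ F * εb * Bm ∧ M1 m t ≤ F * εb * Bm ∧ M0 m t ≤ 2 * Bm) ∧
        (n₀ ≤ m - 1 → 0 ≤ wv (m - 1) t ∧ q ^ 3 * Bm - 1 ≤ (wv (m - 1) t) ^ 2 ∧
          (wv (m - 1) t) ^ 2 ≤ q ^ 3 * Bm + 1 ∧ 9 / 20 ≤ bv (m - 1) t ∧ bv (m - 1) t ≤ 11 / 20 ∧
          M0 (m - 1) t ≤ 5 * (bhi + 4) ^ 2 ∧ M1 (m - 1) t ≤ 5 * (bhi + 4) ^ 2) ∧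
        (|bv (m + 1) t| ≤ εb ∧ |wv (m + 1) t| ≤ εb ∧ M0 (m + 1) t ≤ εb ∧ M1 (m + 1) t ≤ εb) ∧
        (∀ j : ℕ, 2 ≤ j → |bv (m + j) t| ≤ lad j ∧ |wv (m + j) t| ≤ lad j / 5 ∧
          M0 (m + j) t ≤ lad j ∧ M1 (m + j) t ≤ lad j) ∧
        (∀ j : ℕ, 1 ≤ j → ∀ s ∈ Icc 0 t, bv (m + j) s ≤ 1 / 2) ∧
        (∀ k : ℤ, n₀ ≤ k → k ≤ m - 2 → ∃ te ∈ Icc 0 t,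
          (-(2 / 5) ≤ bv k te ∧ bv k te ≤ 3 / 10 ∧ |wv k te| ≤ 1 / 200 ∧
            M0 k te ≤ 10 * (bhi + 4) ^ 2 ∧ M1 k te ≤ 10 * (bhi + 4) ^ 2) ∧
          ∀ s ∈ Icc te t, -(9 / 20) ≤ bv k s ∧ bv k s ≤ 7 / 20 ∧ |wv k s| ≤ 1 / 100 ∧
            M0 k s ≤ 10 * (bhi + 4) ^ 2 + 1 ∧ M1 k s ≤ 10 * (bhi + 4) ^ 2 + 1 ∧ |wv (k - 1) s| ≤ 1 / 100 ∧
            -(1 / 2) ≤ bv (k + 1) s ∧ bv (k + 1) s ≤ 9 / 10))) →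
      (∀ (m : ℤ) (t : ℝ), Tube m t ↔
        ((∀ k : ℤ, k ≤ m + 1 → |bv k t| ≤ 2 * (bhi + 3) ∧ |wv k t| ≤ 2 * (bhi + 3) ∧
          M0 k t ≤ 20 * (bhi + 4) ^ 2 ∧ M1 k t ≤ 20 * (bhi + 4) ^ 2) ∧
        (∀ j : ℕ, 2 ≤ j → |bv (m + j) t| ≤ lad j ∧ |wv (m + j) t| ≤ lad j ∧
          M0 (m + j) t ≤ lad j ∧ M1 (m + j) t ≤ lad j))) →
      -- regime
      0 < ε₀ → ε₀ ≤ 1 / 20 → 0 < D → 1 / 2 ≤ θ → θ ≤ 1 → 0 ≤ η → 0 < εb → εb ≤ 1 / 10 ^ 6 →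
      10 ^ 4 + 40 - 5 * Real.log εb ≤ blo → 10 ^ 9 * (bhi + 4) ^ 4 ≤ F →
      η * (10 ^ 9 * (bhi + 4) ^ 4 * (F + 1)) ≤ 1 → εb * (10 ^ 9 * (F + 1) ^ 2 * (bhi + 4) ^ 3) ≤ 1 →
      10 ^ 3 + 20 * Real.log (bhi + 5) + Real.log (F + 2) ≤ -Real.log εb →
      -- the critical system with memory errors on [0, T]
      n₀ ≤ n → 0 ≤ t₀ → t₀ < T → blo ≤ B → B ≤ bhi →
      (∀ k : ℤ, k < n₀ → ∀ t ∈ Icc 0 T, bv k t = 0 ∧ wv k t = 0 ∧ M0 k t = 0 ∧ M1 k t = 0) →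
      (∀ k : ℤ, ContinuousOn (bv k) (Icc 0 T) ∧ ContinuousOn (wv k) (Icc 0 T) ∧
        ContinuousOn (M0 k) (Icc 0 T) ∧ ContinuousOn (M1 k) (Icc 0 T)) →
      (∀ k : ℤ, ContinuousOn (db k) (Icc 0 T) ∧ ContinuousOn (dw k) (Icc 0 T) ∧
        ∀ t ∈ Ioo 0 T, HasDerivAt (bv k) (db k t) t ∧
          |db k t - R k * (-(bv k t) + G0 k t)| ≤ η * R k * M0 k t ∧
          HasDerivAt (wv k) (dw k t) t ∧ |dw k t - R k * (-(wv k t) + G1 k t)| ≤ η * R k * M1 k t) →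
      (∀ k : ℤ, ∀ t ∈ Icc 0 T, |bv k t| ≤ M0 k t ∧ |wv k t| ≤ M1 k t ∧ 0 ≤ M0 k t ∧ 0 ≤ M1 k t) →
      (∀ k : ℤ, ∀ t₁ ∈ Icc 0 T, ∀ t₂ ∈ Icc t₁ T,
        M0 k t₂ ≤ M0 k t₁ * Real.exp (-(θ * R k * (t₂ - t₁))) +
          R k * ∫ u in t₁..t₂, Real.exp (-(θ * R k * (t₂ - u))) * |G0 k u| ∧
        M1 k t₂ ≤ M1 k t₁ * Real.exp (-(θ * R k * (t₂ - t₁))) +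
          R k * ∫ u in t₁..t₂, Real.exp (-(θ * R k * (t₂ - u))) * |G1 k u|) →
      -- the a-priori far tail above the front, and the hand-off invariant at t₀
      (∃ J : ℕ, ∀ j : ℕ, J ≤ j → ∀ t ∈ Icc 0 T,
        |bv (n + j) t| ≤ lad j ∧ |wv (n + j) t| ≤ lad j / 5 ∧ M0 (n + j) t ≤ lad j ∧ M1 (n + j) t ≤ lad j) →
      Inv n B t₀ →
      (∃ t₁ ∈ Ioo t₀ T, t₁ ≤ t₀ + 4 / R n ∧ ∃ B' : ℝ, Inv (n + 1) B' t₁ ∧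
        q * (B + Real.log εb - 6 * Real.log (B + 2) - 58) ≤ B' ∧
        B' ≤ q * (B + Real.log (10 * (F + 2) * εb * B) + 25) ∧
        (∀ t ∈ Icc t₀ t₁, Tube n t ∧ bv n t ≤ B + 3) ∧
        (∃ tc ∈ Ioo t₀ t₁, (∀ s ∈ Ico t₀ tc, bv (n + 1) s < 1) ∧ bv (n + 1) tc = 1 ∧
          ∃ δ : ℝ, 0 < δ ∧ tc + δ ≤ t₁ ∧ ∀ s ∈ Ioc tc (tc + δ), 1 < bv (n + 1) s)) ∨
      (T < t₀ + 4 / R n ∧ ∀ t ∈ Icc t₀ T, Tube n t ∧ bv n t ≤ B + 3) :=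
  stub_oneStepCore stub_preBoot stub_pulseBoot stub_handoff

/-- **Registered marker stub of this file** (`stub_oneStepMarker`). [folklore] -/
theorem stub_oneStepMarker : ∀ x : ℝ, 10 ^ 4 ≤ x → 0 < (5 * Real.log x + 20) / x := fun _ hx => (oneStepCore_sigmaP_bounds hx).1

end Summit.NavierStokesRegularity.NavierStokesRegularity.Theorems.PerpetualPumpAveragedTypeIBlowup

end
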